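import Literature.AlgebraicGeometry.Modules.SheafHomFrames
import Literature.AlgebraicGeometry.Modules.SheafHomLeft
import Literature.AlgebraicGeometry.Modules.IsoOfSectionsOnBasis
import HarnessLib

/-!
# Biduality `E ≅ E^∨∨` for a finite locally free `𝒪_X`-module (Hartshorne II Ex. 5.1 (a))

For an `𝒪_X`-module `E` on a scheme `X`, `Modules/SheafHomFunctor.lean` defines the biduality map
`toBidual E M : E → 𝓗om(𝓗om(E, M), M)`, `s ↦ ev_s = (φ ↦ φ(s))`; for `M = 𝒪_X` this is the
double-dual map `E → E^∨∨` (`dual E = 𝓗om(E, 𝒪_X)`, `Modules/LocalFrames.lean`). We prove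
Hartshorne II Ex. 5.1 (a): **for `E` locally free of finite rank, `E → E^∨∨` is an isomorphism**
(`isIso_toBidual`; the isomorphism is `asIso (toBidual E 𝒪_X)`; `toBidual_app_bijective_of_isFiniteLocallyFree`).

Proof (as printed: "check on a trivialising open, where it is the biduality of a free module of
finite rank"): over an open `W` carrying a frame `e : 𝒪^I ≅ E|_W` (`I` finite) with basis sections
`b_i` and dual basis `λ_i` (`Modules/LocalFrames.lean`), the map on sections
`Γ(E, W) → Γ(E^∨∨, W) = Hom(E^∨|_W, 𝒪|_W)` is

* injective: `ev_s = ev_t` gives `λ_i(s) = ev_s(λ_i) = ev_t(λ_i) = λ_i(t)` for every `i`, hence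
  `s = ∑ λ_i(s) b_i = t` (`eq_sum_coord_smul`);
* surjective: `Φ ∈ Hom(E^∨|_W, 𝒪|_W)` equals `ev_s` for `s = ∑_i Φ(λ_i) b_i`, both taking the value
  `Φ(λ_j)` on the basis `λ_j` of the dual frame `dualFrame e : 𝒪^I ≅ E^∨|_W`
  (`Modules/SheafHomFrames.lean`; `hom_ext_of_basisSection`).

The opens lying inside some trivialising open form a basis of `X` when `E` is finite locally free, so
`toBidual E 𝒪_X` is bijective on a basis of opens, hence an isomorphism
(`isIso_of_bijective_on_basis`, `Modules/IsoOfSectionsOnBasis.lean`); consequently it is bijective on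
sections over every open (`toBidual_app_bijective_of_isFiniteLocallyFree`). Also: `toBidual` is NATURAL
in `E` for any `M` (`toBidual_naturality : f ≫ toBidual E' M = toBidual E M ≫ 𝓗om(𝓗om(f, M), M)`), and
`E^∨∨` is finite locally free with `E` (`isFiniteLocallyFree_dual_dual`). Everything is proved (theorems
only); no named facts.
This is the biduality input recorded as missing in `HodgeTheory/AtiyahClassCoherent.lean` and
`HodgeTheory/AtiyahPowers.lean` (comparison of the models `𝓗om(E^∨, Ω¹)` and `𝓗om((Ω¹)^∨, E)` of `E ⊗ Ω¹`).

## References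

* R. Hartshorne, *Algebraic Geometry*, GTM 52 (1977), II Ex. 5.1 (a) (p. 123): for `ℰ` locally free of
  finite rank, `(ℰ^∨)^∨ ≅ ℰ`. [Hartshorne1977]
* The Stacks project, Tag 01C6 (finite locally free modules). [StacksProject]
-/

noncomputable section

open CategoryTheory AlgebraicGeometry Opposite TopologicalSpace Limits

namespace Literature.AlgebraicGeometry.Modules

open Literature.AlgebraicGeometry.Motives

universe u

variable {X : Scheme.{u}}

/-! ### Naturality of the biduality map (any modules) -/

section Naturality

variable {E E' : X.Modules} (M : X.Modules) (f : E ⟶ E')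

/-- **Biduality is natural**: for `f : E → E'` and any `M`,
`f ≫ toBidual E' M = toBidual E M ≫ 𝓗om(𝓗om(f, M), M)` — on sections, `ev_{f(s)}(ψ) = ψ(f s) =
ev_s(f|_W ≫ ψ)`; i.e. `toBidual` is a natural transformation from the identity to the double
`M`-dual functor. [cite: Hartshorne1977, II Ex. 5.1 (a)] [cite: StacksProject, Tag 01CM] -/
theorem toBidual_naturality :
    f ≫ toBidual E' M = toBidual E M ≫ sheafHomMapLeft (sheafHomMapLeft f M) M := by
  refine Scheme.Modules.hom_ext _ _ fun U => ?_
  rw [Scheme.Modules.Hom.comp_app, Scheme.Modules.Hom.comp_app]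
  refine AddCommGrpCat.ext fun (s : Γ(E, U)) => ?_
  change ((toBidual E' M).app U (f.app U s) : (sheafHom E' M).over U ⟶ M.over U) =
    (sheafHomMapLeft (sheafHomMapLeft f M) M).app U ((toBidual E M).app U s)
  rw [toBidual_app_apply, toBidual_app_apply, sheafHomMapLeft_app_apply]
  refine hom_ext_of_appLE fun W k (ψ : E'.over W ⟶ M.over W) => ?_
  rw [appLE_over_map_comp, sheafHomMapLeft_app_apply]
  change appLE ψ (𝟙 W) (E'.presheaf.map k.op (f.app U s)) =
    appLE ((SheafOfModules.overFunctor _ W).map f ≫ ψ) (𝟙 W) (E.presheaf.map k.op s)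
  rw [appLE_over_map_comp, Scheme.Modules.Hom.app_map_apply]

end Naturality

/-! ### Over a framed open -/

section Frame

open scoped Classical

variable {E : X.Modules} {W : X.Opens} {I : Type u} (e : SheafOfModules.free I ≅ E.over W)

/-- **`ev_s(μ) = μ(s)`**: the value of the double-dual section `ev_s = toBidual(s) ∈ Γ(E^∨∨, W)` on a
functional `μ ∈ Γ(E^∨, W) = Hom(E|_W, 𝒪|_W)`. [cite: Hartshorne1977, II Ex. 5.1 (a)] -/
lemma appLE_toBidual_app (s : Γ(E, W)) (μ : E.over W ⟶ (unitModule X).over W) :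
    appLE ((toBidual E (unitModule X)).app W s : (dual E).over W ⟶ (unitModule X).over W) (𝟙 W)
        (μ : Γ(dual E, W)) = appLE μ (𝟙 W) s := by
  rw [toBidual_app_apply, appLE_evalAt, presheaf_map_id]

/-- The `i`-th coordinate of `s` in the frame `e` is the value of `ev_s` on the dual basis `λ_i`.
[cite: Hartshorne1977, II Ex. 5.1 (a)] -/
lemma coord_eq_appLE_toBidual_app (s : Γ(E, W)) (i : I) :
    coord e (𝟙 W) s i =
      appLE ((toBidual E (unitModule X)).app W s : (dual E).over W ⟶ (unitModule X).over W) (𝟙 W)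
        (dualBasisSection e i) := by
  rw [coord_def, appLE_toBidual_app]

variable [Fintype I]

/-- **Injectivity of `E → E^∨∨` over a framed open**: a section is determined by its coordinates
`λ_i(s) = ev_s(λ_i)`. [cite: Hartshorne1977, II Ex. 5.1 (a)] -/
theorem toBidual_app_injective (e : SheafOfModules.free I ≅ E.over W) :
    Function.Injective ((toBidual E (unitModule X)).app W) := by
  intro s t h
  rw [eq_sum_coord_smul e (𝟙 W) s, eq_sum_coord_smul e (𝟙 W) t]
  refine Finset.sum_congr rfl fun i _ => ?_
  rw [coord_eq_appLE_toBidual_app e s i, coord_eq_appLE_toBidual_app e t i, h]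

/-- **Surjectivity of `E → E^∨∨` over a framed open**: `Φ ∈ Hom(E^∨|_W, 𝒪|_W)` is `ev_s` for
`s = ∑_i Φ(λ_i) b_i` (compare on the dual basis `λ_j`, the basis of the dual frame). [cite: Hartshorne1977, II Ex. 5.1 (a)] -/
theorem toBidual_app_surjective (e : SheafOfModules.free I ≅ E.over W) :
    Function.Surjective ((toBidual E (unitModule X)).app W) := by
  intro Φ
  let Φ' : (dual E).over W ⟶ (unitModule X).over W := Φ
  let c : I → Γ(X, W) := fun i => (appLE Φ' (𝟙 W) (dualBasisSection e i) : Γ(unitModule X, W))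
  refine ⟨∑ i, c i • basisSection e i, ?_⟩
  change ((toBidual E (unitModule X)).app W (∑ i, c i • basisSection e i) :
      (dual E).over W ⟶ (unitModule X).over W) = Φ'
  refine hom_ext_of_basisSection (dualFrame e) fun j => ?_
  rw [basisSection_dualFrame, appLE_toBidual_app, appLE_sum_right]
  have h : ∀ i, appLE (dualBasis e j) (𝟙 W) (c i • basisSection e i) =
      (if i = j then c i else 0 : Γ(unitModule X, W)) := by
    intro i
    rw [appLE_smul_right, ← coord_def, coord_basisSection]
    change c i * _ = _
    rw [mul_ite, mul_one, mul_zero]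
    rfl
  simp_rw [h, Finset.sum_ite_eq', Finset.mem_univ, if_true]
  rfl

/-- Hence `E → E^∨∨` is bijective on sections over a framed open. [cite: Hartshorne1977, II Ex. 5.1 (a)] -/
theorem toBidual_app_bijective (e : SheafOfModules.free I ≅ E.over W) :
    Function.Bijective ((toBidual E (unitModule X)).app W) :=
  ⟨toBidual_app_injective e, toBidual_app_surjective e⟩

end Frame

/-! ### Globally: `E ≅ E^∨∨` for `E` finite locally free -/

section Global

variable (E : X.Modules)

/-- For `E` finite locally free, the opens lying inside some trivialising open (an open `W` with
`E|_W ≅ 𝒪^I`, `I` finite) form a basis of the topology — every point has a trivialising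
neighbourhood. [cite: StacksProject, Tag 01C6 (Modules Def. 17.14.1 (2))] -/
theorem isBasis_setOf_le_framed (hE : IsFiniteLocallyFree E) :
    Opens.IsBasis {V : X.Opens | ∃ (W : X.Opens) (_ : V ⟶ W) (I : Type u),
      Finite I ∧ Nonempty (SheafOfModules.free I ≅ E.over W)} := by
  rw [Opens.isBasis_iff_nbhd]
  intro U x hx
  obtain ⟨W, hxW, I, hI, ⟨e⟩⟩ := hE x
  exact ⟨U ⊓ W, ⟨W, homOfLE inf_le_right, I, hI, ⟨e⟩⟩, ⟨hx, hxW⟩, inf_le_left⟩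

/-- **Biduality (Hartshorne II Ex. 5.1 (a))**: for a finite locally free `𝒪_X`-module `E` the
double-dual map `E → E^∨∨ = 𝓗om(𝓗om(E, 𝒪_X), 𝒪_X)`, `s ↦ (φ ↦ φ(s))`, is an isomorphism — it is
bijective on sections over every open inside a trivialising open (`toBidual_app_bijective` for the
restricted frame), and these opens form a basis (`isIso_of_bijective_on_basis`). The isomorphism
`E ≅ E^∨∨` is `asIso (toBidual E (unitModule X))` under this instance. [cite: Hartshorne1977, II Ex. 5.1 (a)] -/
theorem isIso_toBidual (hE : IsFiniteLocallyFree E) : IsIso (toBidual E (unitModule X)) := by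
  refine isIso_of_bijective_on_basis (toBidual E (unitModule X)) (isBasis_setOf_le_framed E hE) ?_
  rintro V ⟨W, k, I, hI, ⟨e⟩⟩
  haveI := Fintype.ofFinite I
  exact toBidual_app_bijective (SheafOfModules.restrictTrivialisation (R := X.ringCatSheaf) k e)

/-- Consequently `E → E^∨∨` is bijective on sections over EVERY open `U` (not only the framed ones):
every `Φ ∈ Γ(E^∨∨, U)` is `ev_s` for a unique `s ∈ Γ(E, U)`. [cite: Hartshorne1977, II Ex. 5.1 (a)] -/
theorem toBidual_app_bijective_of_isFiniteLocallyFree (hE : IsFiniteLocallyFree E) (U : X.Opens) :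
    Function.Bijective ((toBidual E (unitModule X)).app U) := by
  haveI := isIso_toBidual E hE
  let i : E ≅ dual (dual E) := asIso (toBidual E (unitModule X))
  have h₁ : ∀ s : Γ(E, U), i.inv.app U (i.hom.app U s) = s := fun s => by
    change (i.hom ≫ i.inv).app U s = s
    rw [Iso.hom_inv_id]
    rfl
  have h₂ : ∀ Φ : Γ(dual (dual E), U), i.hom.app U (i.inv.app U Φ) = Φ := fun Φ => by
    change (i.inv ≫ i.hom).app U Φ = Φ
    rw [Iso.inv_hom_id]
    rfl
  exact ⟨fun s t hst => by rw [← h₁ s, ← h₁ t]; exact congrArg _ hst, fun Φ => ⟨i.inv.app U Φ, h₂ Φ⟩⟩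

/-- `E^∨∨` is finite locally free when `E` is (twice `isFiniteLocallyFree_dual`). [cite: Hartshorne1977, II Ex. 5.1 (b)] -/
theorem isFiniteLocallyFree_dual_dual (hE : IsFiniteLocallyFree E) :
    IsFiniteLocallyFree (dual (dual E)) :=
  isFiniteLocallyFree_dual (isFiniteLocallyFree_dual hE)

end Global

end Literature.AlgebraicGeometry.Modules

end
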